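import Mathlib
import Summits.Ventures.HodgeRepro0.P6NonSimple2Power
import Summits.Ventures.HodgeRepro0.P6NonSimple2PowerConseq
/-!
# P6NonSimple2PowerCompleteLemmas — the vocabulary and the generic lemmas of the completeness theorem
(p6 g10; item P6-54-COMPLETENESS, lead STATUS l.3449 (2); the theorem itself is `P6NonSimple2PowerComplete`)

RAW CONFIGURATIONS of the abstract model (Definition 1.1 of P5-LowDimCensus with `T = ℤ/2 × ℤ/8`, encoded as in
`P6NonSimple2Power`): `⟨ι, Hs, Φs⟩` — an involution, the subgroups `H_b`, the types `Φ_b` (lists of coset names); their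
POINT SET `pts` (`(b, x)`, `x` a coset name of `T/H_b`), SIGN VECTORS `sg` (`t ↦ +1` if `rep_b(t + x) ∈ Φ_b`, else `−1`) and
the CONCLUSION `Q` = `HasPairs`: every nonempty balanced set of points (sign vectors summing to `0`, i.e. `|tΔ ∩ Φ| = |Δ|/2`
for every `t`) contains two distinct points whose sign vectors cancel.  THE ENUMERATIONS of the statement: `involutions`
(all `x ≠ 0` with `x + x = 0`), `Htuples`/`HtuplesF` (all tuples of subgroups of the orders `16/(2 g_b)` not containing `ι`,
faithful), `cmTypes`/`primTypes` (all sublists of the coset names with one coset of each `ι`-pair, primitive = (W3)).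
THE DECIDED FACTS (Boolean functions of a list `L` of listed raw configurations and the block sizes, decided in the theorem
file): `d2` (every primitive type has a translate `findShift` among the listed types of its block), `d3` (every tuple of
listed types is listed), `d4` (shifts permute the coset names, `−s + (s + x) = x`), `d5` (the sign vectors of a shifted
listed type are the original's, relabelled), `d6` (`−s + (s + Φ) = Φ`), `dC` (`fc`/`gc` is a bijection `Fin 8 × Bool ≃ pts`
of a certified configuration carrying `sv (vrep c)` to `sg`).  THE GENERIC LEMMAS: `hasPairs_transfer`, `q_listed`,
`complete_of` (THE ASSEMBLY — the translation reduction lives inside this proof, not in any statement).  Never frozen.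
-/

namespace HodgeRepro0.P6NonSimple2Power

/-- Negation in `T`. -/
def tneg (x : ℕ) : ℕ := 8 * (x / 8) + (8 - x % 8) % 8
/-- The coset names of `T/H`: the least elements of the cosets, sorted. -/
def names (H : List ℕ) : List ℕ := ((elems.map (rep H)).eraseDups).insertionSort (· ≤ ·)
/-- A raw configuration: `ι`, the subgroups `H_b`, the types `Φ_b` (lists of coset names). -/
structure Raw where
  iota : ℕ
  Hs : List (List ℕ)
  Phis : List (List ℕ)

/-- The raw configuration underlying a certified one. -/
def rawOf (c : Cfg) : Raw := ⟨c.iota, c.Hs, c.Phis⟩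
/-- Boolean equality of raw configurations. -/
def rawEq (r r' : Raw) : Bool := r.iota == r'.iota && r.Hs == r'.Hs && r.Phis == r'.Phis
/-- The points of a raw configuration: `(b, x)`, `x` a coset name of `T/H_b`. -/
def pts (r : Raw) : List (ℕ × ℕ) :=
  (List.range r.Hs.length).flatMap (fun b => (names (r.Hs.getD b [])).map (fun x => (b, x)))

/-- The sign of the point `x` of the block `(H, Φ)` at `t`. -/
def sgB (H Phi : List ℕ) (x : ℕ) (t : Fin 16) : ℤ := if rep H (tadd t x) ∈ Phi then 1 else -1
/-- The sign vector of a point of a raw configuration. -/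
def sg (r : Raw) (p : ℕ × ℕ) (t : Fin 16) : ℤ := sgB (r.Hs.getD p.1 []) (r.Phis.getD p.1 []) p.2 t
/-- The translate `s + Φ` of a type (coset names, sorted). -/
def shiftT (H : List ℕ) (s : ℕ) (Phi : List ℕ) : List ℕ := (Phi.map (fun x => rep H (tadd s x))).insertionSort (· ≤ ·)
/-- The balanced-set property of a sign-vector family `u` on a finite set `S` of points: every nonempty balanced subset
contains two distinct points whose sign vectors cancel. -/
def HasPairs {α : Type} (S : Finset α) (u : α → Fin 16 → ℤ) : Prop :=
  ∀ Δ : Finset α, (∀ a ∈ Δ, a ∈ S) → (∀ t, ∑ a ∈ Δ, u a t = 0) → Δ.Nonempty →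
    ∃ a ∈ Δ, ∃ a' ∈ Δ, a ≠ a' ∧ ∀ t, u a t + u a' t = 0

/-- The conclusion for a raw configuration: `HasPairs` on its own point set with its own sign vectors. -/
def Q (r : Raw) : Prop := HasPairs (pts r).toFinset (sg r)
/-- The involutions of `T`. -/
def involutions : List ℕ := elems.filter (fun x => x != 0 && tadd x x == 0)
/-- All tuples of subgroups of the orders `16/(2 g_b)` not containing `ι`. -/
def Htuples (iota : ℕ) : List ℕ → List (List (List ℕ))
  | [] => [[]]
  | g :: gs => (subgroups.filter (fun H => H.length * (2 * g) == 16 && !(iota ∈ H))).flatMap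
      (fun H => (Htuples iota gs).map (fun Hs => H :: Hs))

/-- `T` acts faithfully: the `H_b` intersect in `{0}`. -/
def faithful (Hs : List (List ℕ)) : Bool := elems.all (fun x => x == 0 || !(Hs.all (fun H => x ∈ H)))
/-- The faithful tuples. -/
def HtuplesF (iota : ℕ) (sizes : List ℕ) : List (List (List ℕ)) := (Htuples iota sizes).filter faithful
/-- All sublists (order preserved). -/
def sublists : List ℕ → List (List ℕ)
  | [] => [[]]
  | x :: xs => (sublists xs).flatMap (fun l => [l, x :: l])

/-- The CM types of the block `(H, ι)`: half the coset names, one of each `ι`-pair. -/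
def cmTypes (H : List ℕ) (iota : ℕ) : List (List ℕ) :=
  (sublists (names H)).filter (fun Phi => Phi.length * 2 == (names H).length && Phi.all (fun x => !(rep H (tadd iota x) ∈ Phi)))

/-- `Φ` is primitive: not a union of cosets of any `T′` with `H ⊊ T′ ⊊ T` ((W3) of `P6NonSimple2Power`). -/
def primitiveT (H Phi : List ℕ) : Bool :=
  subgroups.all (fun T' => !(H.all (fun h => h ∈ T') && T'.length > H.length && T'.length < 16) ||
    !(Phi.all (fun r => T'.all (fun s => rep H (tadd r s) ∈ Phi))))

/-- The primitive CM types of the block `(H, ι)`. -/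
def primTypes (H : List ℕ) (iota : ℕ) : List (List ℕ) := (cmTypes H iota).filter (primitiveT H)
/-- The types occurring in the block `b` of the listed configurations with the given `ι` and `Hs`. -/
def listedTypes (L : List Raw) (iota : ℕ) (Hs : List (List ℕ)) (b : ℕ) : List (List ℕ) :=
  ((L.filter (fun r => r.iota == iota && r.Hs == Hs)).map (fun r => r.Phis.getD b [])).eraseDups

/-- A shift `s` with `s + Φ` among the types `Ts` (the first one; `0` if none). -/
def findShift (H : List ℕ) (Ts : List (List ℕ)) (Phi : List ℕ) : ℕ :=
  (elems.find? (fun s => Ts.contains (shiftT H s Phi))).getD 0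

/-- All tuples with one entry from each list. -/
def combos : List (List (List ℕ)) → List (List (List ℕ))
  | [] => [[]]
  | L :: Ls => L.flatMap (fun a => (combos Ls).map (fun xs => a :: xs))

/-- The distinct keys `(H_b, ι, listed types of the block)` over all `ι`, faithful `Hs` and blocks `b`. -/
def keys (L : List Raw) (sizes : List ℕ) : List (List ℕ × ℕ × List (List ℕ)) :=
  (involutions.flatMap (fun iota => (HtuplesF iota sizes).flatMap (fun Hs =>
    (List.range Hs.length).map (fun b => (Hs.getD b [], iota, listedTypes L iota Hs b))))).eraseDups

/-- The distinct pairs `(H, Φ)`, `Φ` a listed type of a block with subgroup `H`. -/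
def pairs (L : List Raw) (sizes : List ℕ) : List (List ℕ × List ℕ) :=
  ((keys L sizes).flatMap (fun k => k.2.2.map (fun Phi => (k.1, Phi)))).eraseDups

/-- The distinct pairs `(H, ι)`. -/
def hiPairs (L : List Raw) (sizes : List ℕ) : List (List ℕ × ℕ) := ((keys L sizes).map (fun k => (k.1, k.2.1))).eraseDups

/-- (D2) for every key and every primitive type `Φ` of its block: the shift `findShift` makes it a listed type. -/
def d2 (L : List Raw) (sizes : List ℕ) : Bool :=
  (keys L sizes).all (fun k => (primTypes k.1 k.2.1).all (fun Phi => k.2.2.contains (shiftT k.1 (findShift k.1 k.2.2 Phi) Phi)))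

/-- (D3) every tuple of listed types is a listed configuration. -/
def d3 (L : List Raw) (sizes : List ℕ) : Bool :=
  involutions.all (fun iota => (HtuplesF iota sizes).all (fun Hs =>
    (combos ((List.range Hs.length).map (fun b => listedTypes L iota Hs b))).all (fun Phis => L.any (rawEq ⟨iota, Hs, Phis⟩))))

/-- (D4) for every subgroup `H`, shift `s` and coset name `x`: `s + x` is a coset name and `−s + (s + x) = x`. -/
def d4 : Bool :=
  subgroups.all (fun H => elems.all (fun s => (names H).all (fun x =>
    rep H (tadd s x) ∈ names H && rep H (tadd (tneg s) (rep H (tadd s x))) == x)))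

/-- (D5) for every pair `(H, Φ)`, shift `s`, coset name `x` and `t`: the sign of `−s + x` in `−s + Φ` is the sign of `x` in
`Φ` (the shifted configuration's sign vectors are the original's, relabelled). -/
def d5 (L : List Raw) (sizes : List ℕ) : Bool :=
  (pairs L sizes).all (fun k => elems.all (fun s => (names k.1).all (fun x => (List.finRange 16).all (fun t =>
    sgB k.1 (shiftT k.1 (tneg s) k.2) (rep k.1 (tadd (tneg s) x)) t == sgB k.1 k.2 x t))))

/-- (D6) for every pair `(H, ι)`, primitive type `Φ` and shift `s`: `−s + (s + Φ) = Φ`. -/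
def d6 (L : List Raw) (sizes : List ℕ) : Bool :=
  (hiPairs L sizes).all (fun k => (primTypes k.1 k.2).all (fun Phi => elems.all (fun s =>
    shiftT k.1 (tneg s) (shiftT k.1 s Phi) == Phi)))

/-- The point of the configuration of `c` corresponding to `(i, b)`: the representative `x_i` or its `ι`-partner. -/
def fc (c : Cfg) (a : Fin 8 × Bool) : ℕ × ℕ :=
  let p := c.reps.getD a.1 (0, 0)
  if a.2 then (p.1, rep (c.Hs.getD p.1 []) (tadd c.iota p.2)) else p

/-- The inverse of `fc` on the point set: the index of the representative whose pair contains the point. -/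
def gc (c : Cfg) (p : ℕ × ℕ) : Fin 8 × Bool :=
  let i := c.reps.findIdx (fun q => q.1 == p.1 && (q.2 == p.2 || rep (c.Hs.getD q.1 []) (tadd c.iota q.2) == p.2))
  (⟨i % 8, Nat.mod_lt _ (by norm_num)⟩, (c.reps.getD i (0, 0)).2 != p.2)

/-- (C) for a certified configuration: `fc` is a bijection `Fin 8 × Bool → pts` with inverse `gc`, carrying `sv (vrep c)` to `sg`. -/
def dC (c : Cfg) : Bool :=
  (pts (rawOf c)).all (fun p => fc c (gc c p) == p) &&
  (List.finRange 8).all (fun i => [false, true].all (fun b =>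
    (List.finRange 16).all (fun t => sg (rawOf c) (fc c (i, b)) t == sv (vrep c) (i, b) t)))


-- ===== generic lemmas =====



/-- Transfer of `HasPairs` along a sign-vector-preserving bijection (with inverse `g`). -/
theorem hasPairs_transfer {α β : Type} [DecidableEq α] [DecidableEq β] (S : Finset α) (P : Finset β)
    (u : α → Fin 16 → ℤ) (w : β → Fin 16 → ℤ) (f : α → β) (g : β → α)
    (hg : ∀ b ∈ P, g b ∈ S ∧ f (g b) = b) (hw : ∀ a ∈ S, ∀ t, w (f a) t = u a t) (hS : HasPairs S u) :
    HasPairs P w := by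
  intro Δ' hΔ'P hbal hne
  set Δ : Finset α := Δ'.image g with hΔ
  have hginj : Set.InjOn g Δ' := by
    intro b hb b' hb' hgb
    have h1 := (hg b (hΔ'P b hb)).2
    have h2 := (hg b' (hΔ'P b' hb')).2
    rw [← h1, ← h2, hgb]
  have hΔS : ∀ a ∈ Δ, a ∈ S := by
    intro a ha
    rw [hΔ, Finset.mem_image] at ha
    obtain ⟨b, hb, rfl⟩ := ha
    exact (hg b (hΔ'P b hb)).1
  have hΔbal : ∀ t, ∑ a ∈ Δ, u a t = 0 := by
    intro t
    rw [hΔ, Finset.sum_image hginj]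
    have : ∀ b ∈ Δ', u (g b) t = w b t := by
      intro b hb
      have hgb := hg b (hΔ'P b hb)
      rw [← hw (g b) hgb.1 t, hgb.2]
    rw [Finset.sum_congr rfl this]
    exact hbal t
  have hΔne : Δ.Nonempty := by
    obtain ⟨b, hb⟩ := hne
    exact ⟨g b, by rw [hΔ]; exact Finset.mem_image_of_mem g hb⟩
  obtain ⟨a, ha, a', ha', hne', hcancel⟩ := hS Δ hΔS hΔbal hΔne
  rw [hΔ, Finset.mem_image] at ha ha'
  obtain ⟨b, hb, rfl⟩ := ha
  obtain ⟨b', hb', rfl⟩ := ha'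
  refine ⟨b, hb, b', hb', ?_, ?_⟩
  · intro h; exact hne' (by rw [h])
  · intro t
    have e1 := hw (g b) (hg b (hΔ'P b hb)).1 t
    have e2 := hw (g b') (hg b' (hΔ'P b' hb')).1 t
    rw [(hg b (hΔ'P b hb)).2] at e1
    rw [(hg b' (hΔ'P b' hb')).2] at e2
    rw [e1, e2]
    exact hcancel t

/-- Membership in the point set. -/
theorem mem_pts (r : Raw) (p : ℕ × ℕ) : p ∈ pts r ↔ p.1 < r.Hs.length ∧ p.2 ∈ names (r.Hs.getD p.1 []) := by
  constructor
  · intro h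
    simp only [pts, List.mem_flatMap, List.mem_range, List.mem_map] at h
    obtain ⟨b, hb, x, hx, rfl⟩ := h
    exact ⟨hb, hx⟩
  · intro ⟨hb, hx⟩
    simp only [pts, List.mem_flatMap, List.mem_range, List.mem_map]
    exact ⟨p.1, hb, p.2, hx, rfl⟩

/-- `rawEq` is sound. -/
theorem eq_of_rawEq (r r' : Raw) (h : rawEq r r' = true) : r = r' := by
  simp only [rawEq, Bool.and_eq_true, beq_iff_eq] at h
  obtain ⟨⟨h1, h2⟩, h3⟩ := h
  cases r; cases r'
  simp only at h1 h2 h3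
  subst h1; subst h2; subst h3; rfl

/-- Entry `b` of a map over `range n`. -/
theorem getD_map_range {α : Type} (f : ℕ → α) (n b : ℕ) (d : α) (hb : b < n) : ((List.range n).map f).getD b d = f b := by
  rw [List.getD_eq_getElem?_getD, List.getElem?_map, List.getElem?_range hb]
  rfl

/-- Membership in `combos`. -/
theorem mem_combos (Ls : List (List (List ℕ))) (xs : List (List ℕ)) (hlen : xs.length = Ls.length)
    (h : ∀ b (_ : b < Ls.length), xs.getD b [] ∈ Ls.getD b []) : xs ∈ combos Ls := by
  induction Ls generalizing xs with
  | nil =>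
    cases xs with
    | nil => simp [combos]
    | cons x xs => simp at hlen
  | cons L Ls ih =>
    cases xs with
    | nil => simp at hlen
    | cons x xs =>
      simp only [combos, List.mem_flatMap, List.mem_map]
      refine ⟨x, ?_, xs, ?_, rfl⟩
      · have := h 0 (by simp); simpa using this
      · refine ih xs (by simpa using hlen) ?_
        intro b hb
        have := h (b + 1) (by simp; omega)
        simpa using this

/-- The first element of `elems` satisfying `p`, or `0`, is in `elems`. -/
theorem findD_mem_elems (p : ℕ → Bool) : (elems.find? p).getD 0 ∈ elems := by
  cases h : elems.find? p with
  | none => simp [elems]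
  | some s => exact List.mem_of_find?_eq_some h


/-- Every entry of a tuple of `Htuples` is one of the listed subgroups. -/
theorem Htuples_mem_sub (iota : ℕ) : ∀ (sizes : List ℕ) (Hs : List (List ℕ)), Hs ∈ Htuples iota sizes →
    ∀ b, b < Hs.length → Hs.getD b [] ∈ subgroups := by
  intro sizes
  induction sizes with
  | nil =>
    intro Hs hHs b hb
    simp only [Htuples, List.mem_singleton] at hHs
    subst hHs; simp at hb
  | cons g gs ih =>
    intro Hs hHs b hb
    simp only [Htuples, List.mem_flatMap, List.mem_map, List.mem_filter] at hHs
    obtain ⟨H, ⟨hHsub, _⟩, Hs', hHs', rfl⟩ := hHs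
    cases b with
    | zero => simpa using hHsub
    | succ b =>
      have := ih Hs' hHs' b (by simp at hb; omega)
      simpa using this

/-- A listed (certified) configuration has `Q` on its point set: transport of the consequence theorem along `fc`/`gc`. -/
theorem q_listed (cs : List Cfg) (hdC : cs.all dC = true)
    (hnp : ∀ c ∈ cs, ∀ Δ : Finset (Fin 8 × Bool), Balanced c Δ → Δ.Nonempty →
      ∃ y ∈ Δ, ∃ z ∈ Δ, y ≠ z ∧ ∀ t, sv (vrep c) y t + sv (vrep c) z t = 0) :
    ∀ r ∈ cs.map rawOf, Q r := by
  intro r hr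
  obtain ⟨c, hc, rfl⟩ := List.mem_map.mp hr
  have h := List.all_eq_true.mp hdC c hc
  simp only [dC, Bool.and_eq_true] at h
  obtain ⟨h1, h2⟩ := h
  unfold Q
  refine hasPairs_transfer (Finset.univ : Finset (Fin 8 × Bool)) (pts (rawOf c)).toFinset (sv (vrep c)) (sg (rawOf c))
    (fc c) (gc c) ?_ ?_ ?_
  · intro p hp
    refine ⟨Finset.mem_univ _, ?_⟩
    have := List.all_eq_true.mp h1 p (List.mem_toFinset.mp hp)
    exact beq_iff_eq.mp this
  · intro a _ t
    obtain ⟨i, b⟩ := a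
    have h3 := List.all_eq_true.mp h2 i (List.mem_finRange i)
    have h4 := List.all_eq_true.mp h3 b (by cases b <;> simp)
    have h5 := List.all_eq_true.mp h4 t (List.mem_finRange t)
    exact beq_iff_eq.mp h5
  · intro Δ _ hbal hne
    exact hnp c hc Δ hbal hne

/-- The key of a block of a configuration of the statement is in `keys`. -/
theorem mem_keys (L : List Raw) (sizes : List ℕ) (iota : ℕ) (hι : iota ∈ involutions) (Hs : List (List ℕ))
    (hHs : Hs ∈ HtuplesF iota sizes) (b : ℕ) (hb : b < Hs.length) :
    (Hs.getD b [], iota, listedTypes L iota Hs b) ∈ keys L sizes := by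
  unfold keys
  rw [List.mem_eraseDups]
  simp only [List.mem_flatMap, List.mem_map, List.mem_range]
  exact ⟨iota, hι, Hs, hHs, b, hb, rfl⟩

/-- THE ASSEMBLY: from the decided facts (D2)–(D6) and `Q` on the listed configurations, `Q` on every configuration of the
statement (the translation reduction lives here, inside the proof). -/
theorem complete_of (L : List Raw) (sizes : List ℕ) (hd2 : d2 L sizes = true) (hd3 : d3 L sizes = true) (hd4 : d4 = true)
    (hd5 : d5 L sizes = true) (hd6 : d6 L sizes = true) (hQ : ∀ r ∈ L, Q r) :
    ∀ iota ∈ involutions, ∀ Hs ∈ HtuplesF iota sizes, ∀ Phis : List (List ℕ), Phis.length = Hs.length →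
      (∀ b (_ : b < Hs.length), Phis.getD b [] ∈ primTypes (Hs.getD b []) iota) → Q ⟨iota, Hs, Phis⟩ := by
  intro iota hι Hs hHs Phis hlen hprim
  have hHs' : Hs ∈ Htuples iota sizes := (List.mem_filter.mp hHs).1
  have hsub : ∀ b, b < Hs.length → Hs.getD b [] ∈ subgroups := Htuples_mem_sub iota sizes Hs hHs'
  have hkey : ∀ b, b < Hs.length → (Hs.getD b [], iota, listedTypes L iota Hs b) ∈ keys L sizes :=
    fun b hb => mem_keys L sizes iota hι Hs hHs b hb
  -- the shifts and the listed configuration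
  set sb : ℕ → ℕ := fun b => findShift (Hs.getD b []) (listedTypes L iota Hs b) (Phis.getD b []) with hsb
  have hsbmem : ∀ b, sb b ∈ elems := fun b => findD_mem_elems _
  set Phis' : List (List ℕ) := (List.range Hs.length).map (fun b => shiftT (Hs.getD b []) (sb b) (Phis.getD b [])) with hPhis'
  have hPhis'b : ∀ b, b < Hs.length → Phis'.getD b [] = shiftT (Hs.getD b []) (sb b) (Phis.getD b []) :=
    fun b hb => getD_map_range _ _ _ _ hb
  have hD2 : ∀ b, b < Hs.length → Phis'.getD b [] ∈ listedTypes L iota Hs b := by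
    intro b hb
    have h1 := List.all_eq_true.mp hd2 _ (hkey b hb)
    have h2 := List.all_eq_true.mp h1 (Phis.getD b []) (hprim b hb)
    rw [hPhis'b b hb]
    exact List.contains_iff_mem.mp h2
  have hmem : (⟨iota, Hs, Phis'⟩ : Raw) ∈ L := by
    have h1 := List.all_eq_true.mp hd3 iota hι
    have h2 := List.all_eq_true.mp h1 Hs hHs
    have hc : Phis' ∈ combos ((List.range Hs.length).map (fun b => listedTypes L iota Hs b)) := by
      refine mem_combos _ _ (by simp [hPhis']) ?_
      intro b hb
      have hb' : b < Hs.length := by simpa using hb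
      rw [getD_map_range _ _ _ _ hb']
      exact hD2 b hb'
    have h3 := List.all_eq_true.mp h2 Phis' hc
    obtain ⟨r, hr, hreq⟩ := List.any_eq_true.mp h3
    rw [eq_of_rawEq _ _ hreq]
    exact hr
  have hQ' : Q ⟨iota, Hs, Phis'⟩ := hQ _ hmem
  have hback : ∀ b, b < Hs.length → Phis.getD b [] = shiftT (Hs.getD b []) (tneg (sb b)) (Phis'.getD b []) := by
    intro b hb
    have hhi : (Hs.getD b [], iota) ∈ hiPairs L sizes := by
      unfold hiPairs
      rw [List.mem_eraseDups, List.mem_map]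
      exact ⟨_, hkey b hb, rfl⟩
    have h1 := List.all_eq_true.mp hd6 _ hhi
    have h2 := List.all_eq_true.mp h1 (Phis.getD b []) (hprim b hb)
    have h3 := List.all_eq_true.mp h2 (sb b) (hsbmem b)
    rw [hPhis'b b hb]
    exact (beq_iff_eq.mp h3).symm
  have hD4 : ∀ b, b < Hs.length → ∀ x ∈ names (Hs.getD b []),
      rep (Hs.getD b []) (tadd (sb b) x) ∈ names (Hs.getD b []) ∧
      rep (Hs.getD b []) (tadd (tneg (sb b)) (rep (Hs.getD b []) (tadd (sb b) x))) = x := by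
    intro b hb x hx
    have h1 := List.all_eq_true.mp hd4 (Hs.getD b []) (hsub b hb)
    have h2 := List.all_eq_true.mp h1 (sb b) (hsbmem b)
    have h3 := List.all_eq_true.mp h2 x hx
    simp only [Bool.and_eq_true, decide_eq_true_eq, beq_iff_eq] at h3
    exact h3
  have hD5 : ∀ b, b < Hs.length → ∀ x ∈ names (Hs.getD b []), ∀ t : Fin 16,
      sgB (Hs.getD b []) (shiftT (Hs.getD b []) (tneg (sb b)) (Phis'.getD b [])) (rep (Hs.getD b []) (tadd (tneg (sb b)) x)) t =
        sgB (Hs.getD b []) (Phis'.getD b []) x t := by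
    intro b hb x hx t
    have hpair : (Hs.getD b [], Phis'.getD b []) ∈ pairs L sizes := by
      unfold pairs
      rw [List.mem_eraseDups]
      simp only [List.mem_flatMap, List.mem_map]
      exact ⟨_, hkey b hb, Phis'.getD b [], hD2 b hb, rfl⟩
    have h1 := List.all_eq_true.mp hd5 _ hpair
    have h2 := List.all_eq_true.mp h1 (sb b) (hsbmem b)
    have h3 := List.all_eq_true.mp h2 x hx
    have h4 := List.all_eq_true.mp h3 t (List.mem_finRange t)
    exact beq_iff_eq.mp h4
  -- transfer along the shift bijection of the point set
  unfold Q
  refine hasPairs_transfer (pts ⟨iota, Hs, Phis'⟩).toFinset (pts ⟨iota, Hs, Phis⟩).toFinset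
    (sg ⟨iota, Hs, Phis'⟩) (sg ⟨iota, Hs, Phis⟩)
    (fun p => (p.1, rep (Hs.getD p.1 []) (tadd (tneg (sb p.1)) p.2)))
    (fun p => (p.1, rep (Hs.getD p.1 []) (tadd (sb p.1) p.2))) ?_ ?_ hQ'
  · intro p hp
    have hp' := (mem_pts _ _).mp (List.mem_toFinset.mp hp)
    obtain ⟨hb, hx⟩ := hp'
    obtain ⟨h1, h2⟩ := hD4 p.1 hb p.2 hx
    refine ⟨List.mem_toFinset.mpr ((mem_pts _ _).mpr ⟨hb, h1⟩), ?_⟩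
    show (p.1, rep (Hs.getD p.1 []) (tadd (tneg (sb p.1)) (rep (Hs.getD p.1 []) (tadd (sb p.1) p.2)))) = p
    rw [h2]
  · intro a ha t
    have ha' := (mem_pts _ _).mp (List.mem_toFinset.mp ha)
    obtain ⟨hb, hx⟩ := ha'
    show sgB (Hs.getD a.1 []) (Phis.getD a.1 []) (rep (Hs.getD a.1 []) (tadd (tneg (sb a.1)) a.2)) t =
      sgB (Hs.getD a.1 []) (Phis'.getD a.1 []) a.2 t
    rw [hback a.1 hb]
    exact hD5 a.1 hb a.2 hx t

end HodgeRepro0.P6NonSimple2Power
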